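import Mathlib
import HarnessLib
import Summits.NavierStokesRegularity.NavierStokesRegularity.Theorems.PoloidalWindowDoorPoloidalWindowRigidityHotForestNoHotCycle

/-!
# Route `PoloidalWindowDoor`, crux `PoloidalWindowRigidity` (K2, stmt-NavierStokesRegularity-19708) — LINE 20 «hot_forest» (ns-idea-8 g10):
# F1b `NoHotLoop` — NO HOMOCLINIC HOT LEAF, VERBATIM (Cruxes-local `Pinned` / `Peakless` / `hotSet` delta-unfolded)

Cell ns-regularity-ideate, seat ns-poloidal-K2-p2 g14 (K2 stub-worker hand; KEY-NS #198).  Statement = `NoHotLoop` of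
`Cruxes/PoloidalWindowRigidity/Lines/hot_forest.lean` (v1.2, sha16 da0c3e1f437fc85c; l.356–362): an injective continuous hot curve `γ`
avoiding `q` cannot converge to `q` at BOTH ends.

PROOF (the line card's: «close the curve up at `q`»).
* `no_loop_of_no_cycle` (abstract): if a closed set `H ⊆ ℝ³` carries no Jordan curve (no continuous `1`-periodic map injective on `[0,1)`
  with values in `H`), then no injective continuous `γ : ℝ → H` converges at both ends to one point `q ∉ range γ`.  The closed-up curve is
  `c := p ∘ fract` with `p s := γ (tan (π (s − ½)))` on `(0,1)` and `p 0 = p 1 := q`: `p` is continuous on `[0,1]` (interior: composition;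
  at `0⁺` / `1⁻`: `tan → ∓∞` (Mathlib `Real.tendsto_tan_neg_pi_div_two` / `Real.tendsto_tan_pi_div_two`) and `γ → q` at `∓∞`), so `c` is
  continuous (`ContinuousOn.comp_fract''`) and `1`-periodic; it is injective on `[0,1)` (`γ`, `tan|(−π/2,π/2)` and the affine map are
  injective, and `γ ≠ q`); its values lie in `H` (`q ∈ H` because `H` is closed and `γ → q`).
* `noHotLoop` (VERBATIM F1b): `H :=` the hot set, closed as a level set of the continuous slice `v₂(−1,·)` inside the closed plane `P₀`
  (slice continuity from `Pinned`'s joint continuity); «no Jordan curve in `H`» is F1a `…HotForestNoHotCycle.noHotCycle` (p701982) BY NAME.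

WHAT THIS IS NOT: not a claim about Navier–Stokes regularity — point-set topology for ONE load-bearing support stub (F1b) of an ideator line of a
door route (bears_on LADDER-NS N0, rung N0-LocalTubeDoorPoloidal, W4 ⟨19708⟩); the research cells ESC-END / CONVERGENT-WEB, C2a′/C2b′, S0,
⟨27893⟩ stay OPEN; crux 19708 / item 20428 OPEN; NS regularity NOT proved.
-/

noncomputable section

-- the summit and its single sub-problem share the name (CONVENTIONS §1), as in every Theorems file
set_option linter.dupNamespace false

namespace Summit.NavierStokesRegularity.NavierStokesRegularity.Theorems.PoloidalWindowDoorPoloidalWindowRigidityHotForestNoHotLoop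

open Set Function Filter Topology Metric Real
open scoped InnerProductSpace RealInnerProductSpace Laplacian
open Summit.NavierStokesRegularity.NavierStokesRegularity.Theorems.PoloidalWindowDoorPoloidalWindowRigidityHotForestNoHotCycle

/-! ## The abstract lemma: closing up a doubly convergent injective curve -/

/-- **No homoclinic injective curve in a closed set without Jordan curves.**  See the module docstring. [folklore] -/
theorem no_loop_of_no_cycle {H : Set (EuclideanSpace ℝ (Fin 3))} (hH : IsClosed H)
    (hcyc : ∀ c : ℝ → EuclideanSpace ℝ (Fin 3), Continuous c → (∀ θ : ℝ, c (θ + 1) = c θ) → Set.InjOn c (Set.Ico 0 1) →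
      (∀ θ : ℝ, c θ ∈ H) → False)
    {γ : ℝ → EuclideanSpace ℝ (Fin 3)} (hγ : Continuous γ) (hinj : Function.Injective γ) (hγH : ∀ τ : ℝ, γ τ ∈ H)
    {q : EuclideanSpace ℝ (Fin 3)} (hq : ∀ τ : ℝ, γ τ ≠ q) (htop : Tendsto γ atTop (𝓝 q)) (hbot : Tendsto γ atBot (𝓝 q)) :
    False := by
  -- `q ∈ H`
  have hqH : q ∈ H := hH.mem_of_tendsto htop (Eventually.of_forall hγH)
  -- the time change `(0,1) → ℝ`, `s ↦ tan (π (s − ½))`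
  set a : ℝ → ℝ := fun s => π * (s - 1 / 2) with ha
  have hac : Continuous a := continuous_const.mul (continuous_id.sub continuous_const)
  have ha_maps : MapsTo a (Ioo 0 1) (Ioo (-(π / 2)) (π / 2)) := fun s hs =>
    ⟨by simp only [ha]; nlinarith [pi_pos, hs.1], by simp only [ha]; nlinarith [pi_pos, hs.2]⟩
  set φ : ℝ → ℝ := fun s => tan (a s) with hφ
  have hφc : ContinuousOn φ (Ioo 0 1) := continuousOn_tan_Ioo.comp hac.continuousOn ha_maps
  have hφinj : InjOn φ (Ioo 0 1) := by
    intro s hs s' hs' h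
    have h' : a s = a s' := injOn_tan (ha_maps hs) (ha_maps hs') h
    simp only [ha] at h'
    nlinarith [pi_pos, h']
  -- the two end limits of `φ`
  have hφ0 : Tendsto φ (𝓝[>] 0) atBot := by
    refine tendsto_tan_neg_pi_div_two.comp (tendsto_nhdsWithin_iff.2 ⟨?_, ?_⟩)
    · have h := hac.tendsto 0
      have e : a 0 = -(π / 2) := by simp only [ha]; ring
      rw [e] at h
      exact h.mono_left nhdsWithin_le_nhds
    · filter_upwards [self_mem_nhdsWithin] with s hs
      simp only [ha, mem_Ioi] at hs ⊢
      nlinarith [pi_pos, hs]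
  have hφ1 : Tendsto φ (𝓝[<] 1) atTop := by
    refine tendsto_tan_pi_div_two.comp (tendsto_nhdsWithin_iff.2 ⟨?_, ?_⟩)
    · have h := hac.tendsto 1
      have e : a 1 = π / 2 := by simp only [ha]; ring
      rw [e] at h
      exact h.mono_left nhdsWithin_le_nhds
    · filter_upwards [self_mem_nhdsWithin] with s hs
      simp only [ha, mem_Iio] at hs ⊢
      nlinarith [pi_pos, hs]
  -- one period of the closed-up curve
  set p : ℝ → EuclideanSpace ℝ (Fin 3) := fun s => if s = 0 ∨ s = 1 then q else γ (φ s) with hp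
  have hp0 : p 0 = q := by simp [hp]
  have hp1 : p 1 = q := by simp [hp]
  have hp_in : ∀ s ∈ Ioo (0 : ℝ) 1, p s = γ (φ s) := fun s hs => by
    simp only [hp, if_neg (not_or.2 ⟨hs.1.ne', hs.2.ne⟩)]
  have hpH : ∀ s, p s ∈ H := fun s => by
    by_cases h : s = 0 ∨ s = 1
    · simp only [hp, if_pos h]; exact hqH
    · simp only [hp, if_neg h]; exact hγH _
  -- continuity of `p` on `[0,1]`
  have hp_at : ∀ s ∈ Ioo (0 : ℝ) 1, ContinuousAt p s := by
    intro s hs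
    have h1 : ContinuousAt (fun s => γ (φ s)) s := hγ.continuousAt.comp (hφc.continuousAt (Ioo_mem_nhds hs.1 hs.2))
    refine h1.congr_of_eventuallyEq ?_
    filter_upwards [Ioo_mem_nhds hs.1 hs.2] with s' hs' using hp_in s' hs'
  have hpR : Tendsto p (𝓝[>] 0) (𝓝 q) := by
    refine (hbot.comp hφ0).congr' ?_
    filter_upwards [Ioo_mem_nhdsGT (zero_lt_one' ℝ)] with s hs using (hp_in s hs).symm
  have hpL : Tendsto p (𝓝[<] 1) (𝓝 q) := by
    refine (htop.comp hφ1).congr' ?_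
    filter_upwards [Ioo_mem_nhdsLT (zero_lt_one' ℝ)] with s hs using (hp_in s hs).symm
  have hpc : ContinuousOn p (Icc 0 1) := by
    intro s hs
    rcases hs.1.eq_or_lt with rfl | hs0
    · -- at `0`
      rw [← continuousWithinAt_sdiff_self]
      show Tendsto p (𝓝[Icc 0 1 \ {0}] 0) (𝓝 (p 0))
      rw [hp0]
      exact hpR.mono_left (nhdsWithin_mono _ fun s hs' => lt_of_le_of_ne hs'.1.1 (Ne.symm hs'.2))
    rcases hs.2.eq_or_lt with rfl | hs1
    · -- at `1`
      rw [← continuousWithinAt_sdiff_self]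
      show Tendsto p (𝓝[Icc 0 1 \ {1}] 1) (𝓝 (p 1))
      rw [hp1]
      exact hpL.mono_left (nhdsWithin_mono _ fun s hs' => lt_of_le_of_ne hs'.1.2 hs'.2)
    · exact (hp_at s ⟨hs0, hs1⟩).continuousWithinAt
  -- the closed-up curve
  set c : ℝ → EuclideanSpace ℝ (Fin 3) := p ∘ Int.fract with hc
  have hcc : Continuous c := hpc.comp_fract'' (hp0.trans hp1.symm)
  have hcper : ∀ θ : ℝ, c (θ + 1) = c θ := fun θ => by
    simp only [hc, Function.comp_apply, Int.fract_add_one]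
  have hcH : ∀ θ : ℝ, c θ ∈ H := fun θ => hpH _
  have hcinj : Set.InjOn c (Set.Ico 0 1) := by
    intro θ hθ θ' hθ' h
    have e : ∀ t ∈ Set.Ico (0 : ℝ) 1, c t = p t := fun t ht => by
      simp only [hc, Function.comp_apply, Int.fract_eq_self.2 ⟨ht.1, ht.2⟩]
    rw [e θ hθ, e θ' hθ'] at h
    rcases hθ.1.eq_or_lt with rfl | h0
    · rcases hθ'.1.eq_or_lt with rfl | h0'
      · rfl
      · rw [hp0, hp_in θ' ⟨h0', hθ'.2⟩] at h
        exact absurd h.symm (hq _)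
    · rcases hθ'.1.eq_or_lt with rfl | h0'
      · rw [hp0, hp_in θ ⟨h0, hθ.2⟩] at h
        exact absurd h (hq _)
      · rw [hp_in θ ⟨h0, hθ.2⟩, hp_in θ' ⟨h0', hθ'.2⟩] at h
        exact hφinj ⟨h0, hθ.2⟩ ⟨h0', hθ'.2⟩ (hinj h)
  exact hcyc c hcc hcper hcinj hcH

/-! ## F1b, VERBATIM -/

/-- **F1b `NoHotLoop` of LINE 20 «hot_forest» (VERBATIM; `Pinned` / `Peakless` / `hotSet` unfolded).**  An injective continuous hot curve
avoiding `q` cannot converge to `q` at both ends.  F1a BY NAME + `no_loop_of_no_cycle`. -/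
theorem noHotLoop :
    ∀ (C : ℝ) (v : ℝ → EuclideanSpace ℝ (Fin 3) → EuclideanSpace ℝ (Fin 3)),
      (Literature.Analysis.FluidPDE.HasTypeITimeDecay C v ∧
        ContinuousOn (Function.uncurry v) (Set.Iio (0 : ℝ) ×ˢ Set.univ) ∧
        (∀ s t : ℝ, s < t → t < 0 → ∀ x, v t x =
          Literature.Analysis.UnboundedOperators.heatExtension (v s) (t - s) x -
            Literature.Analysis.FluidPDE.oseenDuhamel 1 s v v t x) ∧
        (∀ t < 0, Literature.Analysis.FluidPDE.VectorCalculus.IsDivFree (v t)) ∧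
        (∀ s < 0, ∀ y, ⟪Literature.Analysis.FluidPDE.curl (v s) y, EuclideanSpace.single 2 1⟫_ℝ = 0) ∧
        v (-1) 0 2 ≠ 0 ∧ (∀ t < 0, ∀ x, Real.sqrt (-t) * |v t x 2| ≤ |v (-1) 0 2|) ∧
        (∀ h : EuclideanSpace ℝ (Fin 3), fderiv ℝ (v (-1)) 0 h 2 = 0) ∧
        (deriv (fun s => v s 0 2) (-1) = v (-1) 0 2 / 2 ∧ v (-1) 0 2 * (Δ (fun y => v (-1) y 2)) 0 ≤ 0)) →
      (∀ (s z₀ σ M : ℝ) (K O : Set (EuclideanSpace ℝ (Fin 3))), s < 0 →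
        ((σ = 1 ∨ σ = -1) ∧ IsCompact K ∧ K.Nonempty ∧ (∀ y ∈ K, y 2 = z₀ ∧ σ * v s y 2 = M) ∧
          IsOpen O ∧ K ⊆ O ∧ (∀ y ∈ O, y 2 = z₀ → σ * v s y 2 ≤ M) ∧
          (∀ y ∈ O, y 2 = z₀ → σ * v s y 2 = M → y ∈ K)) → False) →
      (∀ y ∈ {y : EuclideanSpace ℝ (Fin 3) | y 2 = 0 ∧ v (-1) y 2 = v (-1) 0 2}, ∀ r : ℝ, 0 < r →
        ∃ y' : EuclideanSpace ℝ (Fin 3), y' 2 = 0 ∧ dist y' y < r ∧ v (-1) y' 2 ≠ v (-1) 0 2) →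
      ∀ γ : ℝ → EuclideanSpace ℝ (Fin 3), Continuous γ → Function.Injective γ →
        (∀ τ : ℝ, γ τ ∈ {y : EuclideanSpace ℝ (Fin 3) | y 2 = 0 ∧ v (-1) y 2 = v (-1) 0 2}) →
        ∀ q : EuclideanSpace ℝ (Fin 3), (∀ τ : ℝ, γ τ ≠ q) →
          Filter.Tendsto γ Filter.atTop (nhds q) → Filter.Tendsto γ Filter.atBot (nhds q) → False := by
  intro C v hP hpk hni γ hγ hinj hhot q hq htop hbot
  -- slice continuity and closedness of the hot set
  have hw : Continuous fun y : EuclideanSpace ℝ (Fin 3) => v (-1) y 2 := by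
    have h1 : Continuous fun y : EuclideanSpace ℝ (Fin 3) => v (-1) y :=
      hP.2.1.comp_continuous (continuous_const.prodMk continuous_id) fun y => ⟨by norm_num, Set.mem_univ _⟩
    exact (EuclideanSpace.proj (𝕜 := ℝ) (2 : Fin 3)).continuous.comp h1
  have h2c : Continuous fun y : EuclideanSpace ℝ (Fin 3) => y 2 := (EuclideanSpace.proj (𝕜 := ℝ) (2 : Fin 3)).continuous
  have hH : IsClosed {y : EuclideanSpace ℝ (Fin 3) | y 2 = 0 ∧ v (-1) y 2 = v (-1) 0 2} := by
    rw [Set.setOf_and]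
    exact (isClosed_eq h2c continuous_const).inter (isClosed_eq hw continuous_const)
  exact no_loop_of_no_cycle hH (noHotCycle C v hP hpk hni) hγ hinj hhot hq htop hbot

end Summit.NavierStokesRegularity.NavierStokesRegularity.Theorems.PoloidalWindowDoorPoloidalWindowRigidityHotForestNoHotLoop

end
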